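import Summits.HodgeConjecture.HodgeConjecture.Theses.EndoscopicMiddleDegree

/-!
# Sketch — crux-ideate `SectorComplement` (stmt-HodgeConjecture-14353), round 1, ideator 1

The crux is the route's DECLARED, NOT-CLAIMED sector frame
`SectorComplement := MiddleDegreeStep → _root_.HodgeConjecture` (auto-cruxed by the gate on the
docstring words "open problem", 2026-08-16). The disprover's Disproof.lean (evidence
20260816T022718Z, rc 0) kernel-checks `SectorComplement ↔ (¬ MiddleDegreeStep ∨ HodgeConjecture)` and
`HodgeConjecture ↔ MiddleDegreeStep ∧ SectorComplement`: the frame IS the Hodge conjecture off the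
sector and no lever closes it short of HC. The only meaningful progress metric is to SHRINK THE
COMPLEMENT: name sub-statements `C` of `HodgeConjecture` (so `HodgeConjecture → C`, checked below) and
levers by which `MiddleDegreeStep`-type sector statements imply them.

This file types the first lemmas of two such levers on the ball-quotient cells of the complement
(compact arithmetic quotients of simple unitary type, dimension `p`, degree `2k`):

* `UpperBandStep` / `ballCell_of_upperBandStep` (card `lefschetz-gysin-funnel`): for `2k ≥ p + 1`
  every rational Hodge `(k,k)`-class is a combination of rational Hodge classes supported on single
  special DIVISORS (hard Lefschetz + Kudla–Millson modularity puts a Lefschetz class in the ℚ-span of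
  special divisor classes); so the upper band reduces to middle degrees of even-dimensional special
  sub-ball quotients, i.e. to `MiddleDegreeStep`-type statements: new cells `(p,k) = (5,3), (7,4), (8,5)`.
* `LefschetzBySpecialDivisors` / `PartnerDeep` / `DeepShallow` / `lowerBandCell_of_shallow` (card
  `deep-cycle-shadows`): for `2k < p` rational Hodge classes are detected by cup product with the
  special divisor classes (hard Lefschetz + Kudla–Millson); the lower band reduces to the middle
  degree of the special divisors (the sector) plus SHALLOWNESS of the special classes of
  codimension `> p/2` — whose failure names a higher Blasius–Rogawski class.

Nothing here is proposed to the gate; `sorry`-free; theorems are glue, content is in the `def`s.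
-/

noncomputable section

namespace Summit.HodgeConjecture.HodgeConjecture.Cruxes.SectorComplement.IdeatorOne

open Literature.AlgebraicGeometry.Motives (SchemeOver)
open Literature.AlgebraicGeometry.HodgeTheory
open Literature.AlgebraicGeometry.ShimuraVarieties
open Literature.AlgebraicTopology.SingularHomology (cupProduct)
open Summit.HodgeConjecture.HodgeConjecture.Theses.EndoscopicMiddleDegree
  (MiddleDegreeStep SectorComplement)

variable {p : ℕ} {X : SchemeOver ℂ}

/-! ### Vocabulary (all over existing declarations) -/

/-- Rational Hodge `(k,k)`-classes in `H^{2k}(X(ℂ); ℂ)` of the `p`-dimensional `X`. -/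
def hdgQ (p : ℕ) (X : SchemeOver ℂ) (k : ℕ) : Set (complexBetti X (2 * k)) :=
  {c | IsRationalClass c ∧ IsOfHodgeType p X (2 * k) k k c}

/-- Degree-`i` classes supported on ONE special cycle `c(W)`, `W ⊆ V` totally positive definite of
`E`-rank `r` (an immersed `(p − r)`-ball quotient of simple type). -/
def specialSupported (D : UnitaryBallQuotientDatum p X) (r i : ℕ) : Set (complexBetti X i) :=
  {c | ∃ W : Submodule D.E (Fin (p + 1) → D.E),
    IsTotallyPositive (conjRingHom D.E) D.H W ∧ Module.finrank D.E W = r ∧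
    c ∈ classesSupportedOn X (D.specialSubvariety W) i}

/-- The Hodge conjecture on the cell `(p, k)`: rational Hodge `(k,k)`-classes of degree `2k` on every
`X` carrying a `UnitaryBallQuotientDatum p X` are algebraic. -/
def BallCell (p k : ℕ) : Prop :=
  ∀ (X : SchemeOver ℂ), Nonempty (UnitaryBallQuotientDatum p X) →
    ∀ c ∈ hdgQ p X k, c ∈ algebraicClasses X k

/-- Every cell is a sub-statement of the summit (the datum records `IsSmoothProjective p X`): cells
are honest pieces of the frame's conclusion. -/
theorem ballCell_of_hodge (h : _root_.HodgeConjecture) (p k : ℕ) : BallCell p k := by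
  rintro X ⟨D⟩ c ⟨hc, hH⟩
  exact (h D.isSmoothProjective).2 k c hc hH

/-- The frame, verbatim (cf. the disprover's `SectorComplement ↔ ¬MiddleDegreeStep ∨ HodgeConjecture`). -/
theorem sectorComplement_iff : SectorComplement ↔ (MiddleDegreeStep → _root_.HodgeConjecture) :=
  Iff.rfl

/-! ### Card `lefschetz-gysin-funnel` — the upper band `p + 1 ≤ 2k ≤ 2p` -/

/-- FIRST LEMMA (one funnel step). On a compact simple-type `p`-ball quotient, for `p + 1 ≤ 2k`,
every rational Hodge `(k,k)`-class lies in the `ℂ`-span of rational Hodge `(k,k)`-classes each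
supported on a SINGLE special divisor `c(W)`, `rank_E W = 1`.
Expected proof: `L : H^{2k-2} → H^{2k}` is onto for `2k − 2 ≥ p − 1` (hard Lefschetz) and onto on
rational Hodge classes (semisimplicity, Voisin 2025 Cor. 2.12 = tree `Voisin2025_hodgeClass_lift_…`);
the Lefschetz class may be taken to be `c₁` of the tautological bundle, which lies in the `ℚ`-span
of the special divisor classes `[Z_β]` because the Kudla–Millson generating series
`[Z_0] + Σ_{β>0} [Z_β] q^β` is a holomorphic Hermitian modular form of weight `p + 1 > 0`
(KudlaMillson1990 Thm 2; a form with vanishing positive coefficients is `0`); and `[Z_β] ∪ α'` is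
supported on `Z_β` (`cupProduct_mem_classesSupportedOn_inter`), rational, of type `(k,k)`. -/
def UpperBandStep (p k : ℕ) : Prop :=
  ∀ (X : SchemeOver ℂ) (D : UnitaryBallQuotientDatum p X), p + 1 ≤ 2 * k → k ≤ p →
    ∀ β ∈ hdgQ p X k, β ∈ Submodule.span ℂ (hdgQ p X k ∩ specialSupported D 1 (2 * k))

/-- The finer typed input behind `UpperBandStep` (one Lefschetz step by a class in the span of the
special divisor classes, onto rational Hodge classes); stated for the cell `(p, k + 1)`. -/
def LefschetzStepBySpecialDivisors (p k : ℕ) : Prop :=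
  ∀ (X : SchemeOver ℂ) (D : UnitaryBallQuotientDatum p X), p + 1 ≤ 2 * (k + 1) → k + 1 ≤ p →
    ∃ h : complexBetti X (2 * 1),
      h ∈ Submodule.span ℂ (hdgQ p X 1 ∩ specialSupported D 1 (2 * 1)) ∧
      ∀ β ∈ hdgQ p X (k + 1), ∃ α ∈ hdgQ p X k,
        β = cupProduct (show 2 * 1 + 2 * k = 2 * (k + 1) by ring) h α

/-- SECTOR INPUT in supported form: rational Hodge `(k,k)`-classes supported on a special divisor are
algebraic. Behind it: such a class is `ν_*γ` for a rational Hodge `(k−1,k−1)`-class `γ` on the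
normalisation `ν : Ỹ → X` of the divisor, a compact simple-type `(p−1)`-ball quotient (Deligne
Hodge III 8.2.8 + semisimplicity, tree `SupportedHodgeClassDescent`), and `ν_*` of an algebraic class
is algebraic; so it is the cell `(p−1, k−1)` — for `2k = p + 1` the MIDDLE degree of `Ỹ`, i.e.
`MiddleDegreeStep` at `m = k − 2` when `p − 1 ∈ {4, 6}`. -/
def SpecialDivisorHodgeAlgebraic (p k : ℕ) : Prop :=
  ∀ (X : SchemeOver ℂ) (D : UnitaryBallQuotientDatum p X),
    ∀ γ ∈ hdgQ p X k ∩ specialSupported D 1 (2 * k), γ ∈ algebraicClasses X k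

/-- The funnel step closes a cell from the two inputs (pure linear algebra: `span_le`). -/
theorem ballCell_of_upperBandStep {p k : ℕ} (hU : UpperBandStep p k)
    (hS : SpecialDivisorHodgeAlgebraic p k) (hpk : p + 1 ≤ 2 * k) (hk : k ≤ p) : BallCell p k := by
  rintro X ⟨D⟩ c hc
  exact (Submodule.span_le.mpr fun γ hγ ↦ hS X D γ hγ) (hU X D hpk hk c hc)

/-- New cell `(5, 3)`: degree 6 on compact simple-type 5-ball quotients (outside BMM Cor. 2:
`3 ∈ ]5/3, 10/3[`), from the funnel step and the sector at `m = 1` (degree 4 of the 4-ball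
special divisors; their own lower hypothesis is Lefschetz (1,1)). -/
theorem cell_5_3 (hU : UpperBandStep 5 3) (hS : SpecialDivisorHodgeAlgebraic 5 3) : BallCell 5 3 :=
  ballCell_of_upperBandStep hU hS (by norm_num) (by norm_num)

/-- New cell `(7, 4)`: degree 8 on 7-ball quotients (`4 ∈ ]7/3, 14/3[`), from the sector at `m = 2`
(degree 6 = middle of the 6-ball special divisors; their lower hypothesis, degree 4, is BMM Cor. 2
at `(6, 2)`). -/
theorem cell_7_4 (hU : UpperBandStep 7 4) (hS : SpecialDivisorHodgeAlgebraic 7 4) : BallCell 7 4 :=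
  ballCell_of_upperBandStep hU hS (by norm_num) (by norm_num)

/-- New cell `(8, 5)`: degree 10 on 8-ball quotients (`5 ∈ ]8/3, 16/3[`); two funnel steps
(`(8,5) → (7,4) → (6,3)`), the second being `cell_7_4` read on the divisors. -/
theorem cell_8_5 (hU : UpperBandStep 8 5) (hS : SpecialDivisorHodgeAlgebraic 8 5) : BallCell 8 5 :=
  ballCell_of_upperBandStep hU hS (by norm_num) (by norm_num)

/-! ### Card `deep-cycle-shadows` — the lower band `2k < p` (cells `(2k+3, k+1)`, codimension `c = 1`)

For a lower-band class `α ∈ Hdg^{2(k+1)}_ℚ(X^{2k+3})` the hard-Lefschetz partner `α ∪ L` lives in the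
upper band; `L` is a combination of special DIVISOR classes (Kudla–Millson), so `α` is SEEN by the
special divisors `Y` (which are `2(k+1)`-ball quotients, `α|_Y` in their MIDDLE degree — the sector)
and `α ∪ [Y] = ν_*(ν^* α)`. If the sector (`MiddleThetaSpan` on `Ỹ`) plus Gysin descent put every
`α ∪ [Y]` in the special–Lefschetz ring `R` of `X` (`PartnerDeep`), then `α = L^{-1}(Σ a_t α ∪ [Z_t])`
is a LEFSCHETZ SHADOW of deep special classes, and the cell follows from SHALLOWNESS of deep special
classes (`DeepShallow`: `R_{k+2} = L ∪ R_{k+1}`, i.e. the Kudla–Millson series of codimension `> p/2`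
is cohomologically Eisenstein). Failure of `DeepShallow` = an explicit rational Hodge class
`L^{-1}[Z_T] ∉ R` — a higher Blasius–Rogawski class (route crux stmt-13662) with a name. -/

/-- A **special–Lefschetz ring** for the datum: submodules `R_j ⊆ H^{2j}` containing the classes
supported on codimension-`j` special cycles, stable under cup product with divisor classes, and
consisting of algebraic classes (intended: the subring generated by special cycle classes and
`Alg¹`; `R_j := algebraicClasses X j` is the maximal instance, given `CupProductAlgebraic`). -/
structure SpecialLefschetzRing (D : UnitaryBallQuotientDatum p X) where
  /-- the degree-`2j` piece -/
  R : ∀ j : ℕ, Submodule ℂ (complexBetti X (2 * j))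
  special_le : ∀ j, Submodule.span ℂ (specialSupported D j (2 * j)) ≤ R j
  cup_mem : ∀ j, ∀ x ∈ R j, ∀ d ∈ algebraicClasses X 1,
    cupProduct (two_mul_add_two_mul j 1) x d ∈ R (j + 1)
  le_alg : ∀ j, R j ≤ algebraicClasses X j

/-- Rational `(1,1)`-classes supported on special divisors (the special divisor classes). -/
def specialDivisorClasses (D : UnitaryBallQuotientDatum p X) : Set (complexBetti X (2 * 1)) :=
  hdgQ p X 1 ∩ specialSupported D 1 (2 * 1)

/-- VISIBILITY (free): on a compact simple-type `(2k+3)`-ball quotient some class `h` in the span of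
the special divisor classes has `· ∪ h : H^{2(k+1)} → H^{2(k+2)}` injective. Expected proof: hard
Lefschetz in the degrees `2k+2, 2k+4` symmetric about `p = 2k+3`, with `h = c₁(taut) ∈ ℚ`-span of the
`[Z_t]` (Kudla–Millson modularity, weight `p+1 > 0`). -/
def LefschetzBySpecialDivisors (k : ℕ) : Prop :=
  ∀ (X : SchemeOver ℂ) (D : UnitaryBallQuotientDatum (2 * k + 3) X),
    ∃ h ∈ Submodule.span ℂ (specialDivisorClasses D),
      Function.Injective
        (fun x : complexBetti X (2 * (k + 1)) ↦ cupProduct (two_mul_add_two_mul (k + 1) 1) x h)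

/-- SECTOR INPUT (partner is deep-special): the product of a lower-band rational Hodge class with a
special divisor class — `= ν_*(ν^*α)`, `ν^*α` a MIDDLE-degree rational Hodge class of the
`2(k+1)`-ball quotient `Ỹ` — lies in the special–Lefschetz ring. Behind it: `MiddleThetaSpan` at
`m = k` on `Ỹ` and Gysin descent (`ν_*` of `Ỹ`'s special–Lefschetz ring lands in `X`'s; crux-13661
card gysin-seesaw-descent). -/
def PartnerDeep {k : ℕ} {X : SchemeOver ℂ} {D : UnitaryBallQuotientDatum (2 * k + 3) X}
    (R : SpecialLefschetzRing D) : Prop :=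
  ∀ α ∈ hdgQ (2 * k + 3) X (k + 1), ∀ s ∈ specialDivisorClasses D,
    cupProduct (two_mul_add_two_mul (k + 1) 1) α s ∈ R.R (k + 1 + 1)

/-- SHALLOWNESS OF DEEP SPECIAL CLASSES (the card's crux): dividing the upper-band piece of the
special–Lefschetz ring by a Lefschetz class from the special-divisor span stays in the ring:
`x ∪ h ∈ R_{k+2} ⟹ x ∈ R_{k+1}`. Equivalently (hard Lefschetz is bijective here) `R_{k+2} = R_{k+1} ∪ h`:
the codimension-`(k+2)` Kudla–Millson classes of the `(2k+3)`-ball quotient are generated by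
codimension-`(k+1)` ones and `L` — "the KM generating series above the middle codimension is
cohomologically Eisenstein". Its failure exhibits `L^{-1}[Z_T] ∉ R_{k+1}`: a named rational Hodge
class outside the special span. -/
def DeepShallow {k : ℕ} {X : SchemeOver ℂ} {D : UnitaryBallQuotientDatum (2 * k + 3) X}
    (R : SpecialLefschetzRing D) : Prop :=
  ∀ h ∈ Submodule.span ℂ (specialDivisorClasses D),
    Function.Injective
        (fun x : complexBetti X (2 * (k + 1)) ↦ cupProduct (two_mul_add_two_mul (k + 1) 1) x h) →
      ∀ x : complexBetti X (2 * (k + 1)),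
        cupProduct (two_mul_add_two_mul (k + 1) 1) x h ∈ R.R (k + 1 + 1) → x ∈ R.R (k + 1)

/-- The lower-band reduction: visibility + (sector ⟹ partner deep-special) + shallowness ⟹ the cell
`(2k+3, k+1)`; pure linear algebra (`span_le` into the `comap` of `α ∪ ·`). -/
theorem lowerBandCell_of_shallow (k : ℕ) (hV : LefschetzBySpecialDivisors k)
    (hPS : ∀ (X : SchemeOver ℂ) (D : UnitaryBallQuotientDatum (2 * k + 3) X),
      ∃ R : SpecialLefschetzRing D, PartnerDeep R ∧ DeepShallow R) :
    BallCell (2 * k + 3) (k + 1) := by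
  rintro X ⟨D⟩ α hα
  obtain ⟨R, hP, hS⟩ := hPS X D
  obtain ⟨h, hh, hinj⟩ := hV X D
  have hle : Submodule.span ℂ (specialDivisorClasses D) ≤
      (R.R (k + 1 + 1)).comap (cupProduct (two_mul_add_two_mul (k + 1) 1) α) :=
    Submodule.span_le.mpr fun s hs ↦ hP α hα s hs
  exact R.le_alg (k + 1) (hS h hh hinj α (hle hh))

/-- The cell `(5, 2)` (`k = 1`): rational Hodge `(2,2)`-classes of compact simple-type 5-ball quotients
— the home of route crux `HigherBlasiusRogawskiClass` — from visibility, the sector on the 4-ball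
special divisors, and shallowness of codimension-3 special classes. -/
theorem cell_5_2 (hV : LefschetzBySpecialDivisors 1)
    (hPS : ∀ (X : SchemeOver ℂ) (D : UnitaryBallQuotientDatum (2 * 1 + 3) X),
      ∃ R : SpecialLefschetzRing D, PartnerDeep R ∧ DeepShallow R) :
    BallCell 5 2 :=
  lowerBandCell_of_shallow 1 hV hPS

/-! ### Card `kottwitz-rigidity` — the endoscopy-free cell (division-algebra ball quotients)

There is no datum in the tree for compact unitary Shimura varieties attached to a DIVISION ALGEBRA
with involution of the second kind (Kottwitz's simple Shimura varieties); the predicate is left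
abstract (`K`, definition request D1 of the card) and only the logical shell is typed: on that cell
the lever predicts `LefschetzOnly` (every rational Hodge class is a multiple of one algebraic class
per degree, namely `L^k`), and `LefschetzOnly` varieties satisfy the Hodge conjecture outright. -/

/-- Every rational Hodge class of degree `2k` is a complex multiple of ONE algebraic class `ℓ_k`
(intended: `ℓ_k = L^k`, `L = c₁(K_X)`). -/
def LefschetzOnly (p : ℕ) (X : SchemeOver ℂ) : Prop :=
  ∀ k, ∃ ℓ ∈ algebraicClasses X k, ∀ c ∈ hdgQ p X k, ∃ t : ℂ, c = t • ℓ

/-- `LefschetzOnly` varieties (with a Hodge model) satisfy the Hodge conjecture — no cycle beyond the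
`ℓ_k` is ever needed. -/
theorem hodgeConjectureFor_of_lefschetzOnly (hA : Nonempty (HodgeModel p X))
    (hL : LefschetzOnly p X) : HodgeConjectureFor p X := by
  refine ⟨hA, fun k c hc hH ↦ ?_⟩
  obtain ⟨ℓ, hℓ, h⟩ := hL k
  obtain ⟨t, rfl⟩ := h c ⟨hc, hH⟩
  exact Submodule.smul_mem _ t hℓ

/-- The cell, over an abstract membership predicate `K p X` ("`X` is a compact unitary ball quotient of
division-algebra type, dimension `p`"): the card's substantive (informal) first lemma
`TateFreeSpehPieces` + "Hodge ⟹ absolute Hodge on the cell" give `LefschetzOnly`, whence HC on the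
whole cell, all degrees, with no cycle construction. -/
theorem kottwitzCell (K : ℕ → SchemeOver ℂ → Prop)
    (hK : ∀ p X, K p X → Nonempty (HodgeModel p X) ∧ LefschetzOnly p X) :
    ∀ p X, K p X → HodgeConjectureFor p X :=
  fun p X h ↦ hodgeConjectureFor_of_lefschetzOnly (hK p X h).1 (hK p X h).2

end Summit.HodgeConjecture.HodgeConjecture.Cruxes.SectorComplement.IdeatorOne

end
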